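/-
Copyright: the b2b-balaban T⁴-continuum CRUX team, row NE7b OWNER lineage `t4-ne7b-p1` (gen 118). Project licence.
-/
import Summits.QuantumFields.BalabanUV.T4Continuum.Spine.NE7b.SupTorusRegionalBackground

/-!
# THE DIRICHLET PRINCIPLE FOR THE REGIONAL BACKGROUND: two regional backgrounds over the same blocks `Λ` with the SAME block data
# and exterior fields `ψ₁, ψ₂` differ, in the linearised energy `⟨δ, At δ⟩` and in `ℓ²`, by at most the `At`-energy of the
# exterior perturbation extended by zero into `Ω` — `((γ − λ)∕γ)²·⟨δ, At δ⟩ ≤ ⟨e, At e⟩`, `(γ − λ)²·Σ δ² ≤ γ·⟨e, At e⟩`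
# (`γ = min(2,a)`, `0 ≤ λ < γ`, `δ = φ₁ − φ₂`, `e = δ·1_{off Ω}`): the exterior field enters the background only through
# `⟨δ, At e⟩`, a pairing supported within the range of `At` around the exterior — the seed of every locality statement, here
# with mesh- and volume-free constants and no smallness
# (row NE7b, node U5c; (92) + (103) + TEA BY NAME; [folklore])

Cell `pub-balaban`, sub-cell `t4`, spine estimate NE7b (`T4WeightBudget.RelWeightBound`; the cell's OWN estimate — NOT PRINTED in
[Bałaban 1983–89], NOT PROVED).  Crux-route work under `Spine/NE7b/` by the row OWNER (`t4-ne7b-p1` gen 118) under FREEZE (0)'s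
crux-prover clause, second layer of gen 117's located item (b) «the REGIONAL background»; NOTHING of Bałaban's is named as a Lean
object, valued or asserted; no `T4Continuum/Support` leaf typed; no `def`, no notation; zero `sorry`.  Imports (BY NAME): the
OWNER's (103) `…SupTorusRegionalBackground` (`regional_critical_of_sitewise` ∕ `apply_eq_zero_of_regional`; through it (92)
`mul_sub_mul_sub_ge`, (89) `torus_form_coercive`, TEA `fderiv_action_apply`, TDF `torus_operator_form_symm`).

WHY (located).  [B4]'s regional analysis rests on comparing the backgrounds of one region under two exterior configurations (and
of two nested regions); the sup road's decoupling letters (64) do this in weighted `ℓ^∞` under two-sided curvature.  In the convex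
regime the comparison is the Dirichlet principle: both field equations kill `ker QΛ`, which contains `δ − e` (the two data agree on
`Λ`, and `e` carries the exterior difference), so `⟨At δ, δ⟩ + Σ (u(φ₁) − u(φ₂))·(δ − e) = ⟨At δ, e⟩`; off `Ω` the fields ARE the
exterior data, so `δ − e` vanishes there and the potential term is `≥ −λ·Σ δ² ≥ −(λ∕γ)·⟨At δ, δ⟩` by the secant floor; and
`⟨At δ, e⟩² ≤ ⟨At δ, δ⟩·⟨At e, e⟩` (Cauchy–Schwarz for the nonnegative symmetric form).  No upper bound on `u′` is used: the
exterior perturbation is tested only where the two fields coincide with their data.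

WHAT IS PROVED ([folklore]):
* §1 (TEA's level: symmetric `At` with a form floor `γ`, `0 ≤ λ < γ`, `u′ ≥ −λ`; ANY `Qt`) `form_cauchySchwarz` (`⟨At f, g⟩² ≤
  ⟨At f, f⟩·⟨At g, g⟩` for a symmetric nonnegative form), `critical_pairing_identity` (two fibre-critical fields of the SAME action
  and ANY `e` with `Qt(φ₁ − φ₂ − e) = 0`: `⟨At δ, δ⟩ + Σ (u(φ₁ x) − u(φ₂ x))·(δ x − e x) = Σ (At δ) x·e x`),
  **`critical_energy_le_of_agree`** (if moreover `e x ≠ 0 → e x = δ x`: `((γ − λ)∕γ)²·⟨At δ, δ⟩ ≤ ⟨At e, e⟩`),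
  **`critical_sq_le_of_agree`** (`(γ − λ)²·Σ δ² ≤ γ·⟨At e, e⟩`).
* §2 (the `Beta.Site` carriers, the Dirichlet fibres of (103); `0 ≤ λ < min(2,a)`) THE END **`regional_exterior_stability`**: two
  fields solving the sitewise equation over `Ω` with `QΛ φ₁ (inl y) = QΛ φ₂ (inl y)` on `Λ`:
  `((min(2,a) − λ)∕min(2,a))²·⟨δ, At δ⟩ ≤ ⟨e, At e⟩` and `(min(2,a) − λ)²·Σ_x δ x² ≤ min(2,a)·⟨e, At e⟩`, `e x = δ x` off `Ω`, `0` on `Ω`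
  (`At = Rf∘Aop∘Ef`).
* §3 toy.

HONEST (what this is NOT).  An energy estimate: the right side is the `At`-ENERGY of the zero-extended exterior difference (on the
torus `(n+1)²·Σ_bonds (e x − e x′)² + a(n+1)^d·Σ_y (Q′t e)²` — large for rough exterior data; no trace ∕ harmonic-extension
optimisation is done), NOT a pointwise or weighted decay statement: the DECAY of the influence into `Ω` (locality proper, [B4]) is not
touched; `0 ≤ λ` assumed (a convex potential is the case `λ = 0`); constants OURS; nothing about the measure; cubic periods; scalar
skeleton, hard constraint, not the covariant operators ((A3), NC-NE7b-α UNRULED); nothing of Bałaban's.  BY-NAME EFFECT ON THE WALL: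
NONE.  NE7b NOT PRINTED ∕ NOT PROVED; spine PROVED 0∕9; rung (B)+1 on a FINITE torus — NOT infinite volume, NOT the mass gap, NOT Clay.
HONEST DEPENDENCY: continuum YM on T⁴ ⇐ BetaPertH ∧ nine spine estimates (0∕9 proved); BetaPertH ⇐ (D1) ∧ (D4) ∧ CAP+tail; G-an2-4
gates asym, D1 and NE2∕3∕4.
-/

set_option autoImplicit false

noncomputable section

namespace Summit.QuantumFields.BalabanUV.T4Continuum.NE7b.SupTorusRegionalExteriorStability

open Set Function
open scoped ENNReal
open Literature.MathematicalPhysics.QuantumFieldTheory.Balaban1983to89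
open B6QGQLower276 (X blk B side AX)
open B5Hk103ScalarZd (nbhd)
open Beta (Site siteOf windowMap)
open SupTorusDirichletForm (torus_operator_form_symm)
open SupTorusDirichletFormCoercive (torus_form_coercive)
open SupTorusEffectiveAction (fderiv_action_apply)
open SupTorusActionConvex (mul_sub_mul_sub_ge)
open SupTorusRegionalBackground (regional_critical_of_sitewise apply_eq_zero_of_regional)

variable {d : ℕ}

/-! ## §1. TEA's level: Cauchy–Schwarz for the form, the pairing identity, the Dirichlet principle -/

section Generic

variable {ι κ : Type*} [Fintype ι]

/-- **CAUCHY–SCHWARZ FOR A NONNEGATIVE SYMMETRIC FORM**: `Σ ψ·At φ = Σ φ·At ψ` and `0 ≤ Σ h·At h` give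
`(Σ_x (At f) x·g x)² ≤ (Σ_x f x·(At f) x)·(Σ_x g x·(At g) x)`. [folklore] -/
theorem form_cauchySchwarz (At : (ι → ℝ) →L[ℝ] (ι → ℝ))
    (hAt : ∀ φ ψ : ι → ℝ, ∑ x, ψ x * At φ x = ∑ x, φ x * At ψ x) (hpos : ∀ h : ι → ℝ, 0 ≤ ∑ x, h x * At h x)
    (f g : ι → ℝ) :
    (∑ x, At f x * g x) ^ 2 ≤ (∑ x, f x * At f x) * ∑ x, g x * At g x := by
  set A : ℝ := ∑ x, f x * At f x with hA
  set Bfg : ℝ := ∑ x, At f x * g x with hB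
  set C : ℝ := ∑ x, g x * At g x with hC
  -- the form along `f - t•g`
  have hquad : ∀ t : ℝ, 0 ≤ A - 2 * t * Bfg + t ^ 2 * C := by
    intro t
    have h0 := hpos (f - t • g)
    have hexp : ∑ x, (f - t • g) x * At (f - t • g) x = A - 2 * t * Bfg + t ^ 2 * C := by
      have hlin : ∀ x, At (f - t • g) x = At f x - t * At g x := fun x => by
        rw [map_sub, map_smul]; rfl
      simp only [hlin, Pi.sub_apply, Pi.smul_apply, smul_eq_mul]
      have hsym : ∑ x, g x * At f x = ∑ x, f x * At g x := hAt f g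
      have hB' : Bfg = ∑ x, g x * At f x := by rw [hB]; exact Finset.sum_congr rfl fun x _ => by ring
      have hsplit : ∑ x, (f x - t * g x) * (At f x - t * At g x)
          = ∑ x, f x * At f x - t * ∑ x, f x * At g x - t * ∑ x, g x * At f x + t ^ 2 * ∑ x, g x * At g x := by
        rw [Finset.mul_sum, Finset.mul_sum, Finset.mul_sum, ← Finset.sum_sub_distrib, ← Finset.sum_sub_distrib,
          ← Finset.sum_add_distrib]
        exact Finset.sum_congr rfl fun x _ => by ring
      rw [hsplit, ← hsym, ← hB', hA, hC]
      ring
    rw [hexp] at h0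
    exact h0
  have hC0 : 0 ≤ C := hpos g
  by_cases hCz : C = 0
  · -- `C = 0` forces `Bfg = 0`
    have hB0 : Bfg = 0 := by
      by_contra hne
      have h1 := hquad ((A + 1) / (2 * Bfg))
      rw [hCz, mul_zero, add_zero] at h1
      have h2 : 2 * ((A + 1) / (2 * Bfg)) * Bfg = A + 1 := by field_simp
      rw [h2] at h1
      linarith
    rw [hB0, hCz]
    simp
  · have hCpos : 0 < C := lt_of_le_of_ne hC0 (Ne.symm hCz)
    have h1 := hquad (Bfg / C)
    have h2 : A - 2 * (Bfg / C) * Bfg + (Bfg / C) ^ 2 * C = A - Bfg ^ 2 / C := by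
      field_simp
      ring
    rw [h2] at h1
    have h3 : Bfg ^ 2 / C ≤ A := by linarith
    rwa [div_le_iff₀ hCpos] at h3

/-- **THE PAIRING IDENTITY BETWEEN TWO FIBRE-CRITICAL FIELDS OF THE SAME ACTION**: `φ₁, φ₂` fibre-critical (`DS(φ_i)` kills
`ker Qt`), `δ = φ₁ − φ₂`, and ANY `e` with `Qt (δ − e) = 0` ⟹
`Σ δ·At δ + Σ (u(φ₁ x) − u(φ₂ x))·(δ x − e x) = Σ (At δ) x·e x`. [folklore] -/
theorem critical_pairing_identity (At : (ι → ℝ) →L[ℝ] (ι → ℝ))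
    (hAt : ∀ φ ψ : ι → ℝ, ∑ x, ψ x * At φ x = ∑ x, φ x * At ψ x) {v u : ℝ → ℝ} (hv : ∀ t, HasDerivAt v (u t) t)
    (Qt : (ι → ℝ) →L[ℝ] (κ → ℝ)) {φ₁ φ₂ e : ι → ℝ} (he : Qt (φ₁ - φ₂ - e) = 0)
    (hcrit₁ : ∀ h : ι → ℝ, Qt h = 0 →
      fderiv ℝ (fun φ : ι → ℝ => (1 / 2 : ℝ) * ∑ x, φ x * At φ x + ∑ x, v (φ x)) φ₁ h = 0)
    (hcrit₂ : ∀ h : ι → ℝ, Qt h = 0 →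
      fderiv ℝ (fun φ : ι → ℝ => (1 / 2 : ℝ) * ∑ x, φ x * At φ x + ∑ x, v (φ x)) φ₂ h = 0) :
    ∑ x, (φ₁ x - φ₂ x) * At (φ₁ - φ₂) x + ∑ x, (u (φ₁ x) - u (φ₂ x)) * ((φ₁ x - φ₂ x) - e x)
      = ∑ x, At (φ₁ - φ₂) x * e x := by
  have h1 : ∑ x, (At φ₁ x + u (φ₁ x)) * (φ₁ - φ₂ - e) x = 0 := by
    rw [← fderiv_action_apply At hAt hv φ₁ (φ₁ - φ₂ - e)]; exact hcrit₁ _ he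
  have h2 : ∑ x, (At φ₂ x + u (φ₂ x)) * (φ₁ - φ₂ - e) x = 0 := by
    rw [← fderiv_action_apply At hAt hv φ₂ (φ₁ - φ₂ - e)]; exact hcrit₂ _ he
  have hlin : ∀ x, At (φ₁ - φ₂) x = At φ₁ x - At φ₂ x := fun x => by rw [map_sub]; rfl
  have hdiff : ∑ x, (At φ₁ x + u (φ₁ x)) * (φ₁ - φ₂ - e) x - ∑ x, (At φ₂ x + u (φ₂ x)) * (φ₁ - φ₂ - e) x
      = ∑ x, (φ₁ x - φ₂ x) * At (φ₁ - φ₂) x + ∑ x, (u (φ₁ x) - u (φ₂ x)) * ((φ₁ x - φ₂ x) - e x)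
        - ∑ x, At (φ₁ - φ₂) x * e x := by
    rw [← Finset.sum_sub_distrib, ← Finset.sum_add_distrib, ← Finset.sum_sub_distrib]
    exact Finset.sum_congr rfl fun x _ => by simp only [hlin, Pi.sub_apply]; ring
  have h0 : ∑ x, (At φ₁ x + u (φ₁ x)) * (φ₁ - φ₂ - e) x - ∑ x, (At φ₂ x + u (φ₂ x)) * (φ₁ - φ₂ - e) x = 0 := by
    rw [h1, h2, sub_zero]
  rw [hdiff] at h0
  linarith

/-- **THE DIRICHLET PRINCIPLE, ENERGY FORM**: symmetric `At` with floor `γ`, `0 ≤ λ < γ`, `u′ ≥ −λ`; two fibre-critical fields of the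
same action; `e` with `Qt (δ − e) = 0` AGREEING WITH `δ` ON ITS SUPPORT (`e x ≠ 0 → e x = δ x`).  Then
`((γ − λ)∕γ)²·Σ δ·At δ ≤ Σ e·At e`. [folklore] -/
theorem critical_energy_le_of_agree (At : (ι → ℝ) →L[ℝ] (ι → ℝ))
    (hAt : ∀ φ ψ : ι → ℝ, ∑ x, ψ x * At φ x = ∑ x, φ x * At ψ x) {γ : ℝ}
    (hγ : ∀ h : ι → ℝ, γ * ∑ x, h x ^ 2 ≤ ∑ x, h x * At h x) {v u u' : ℝ → ℝ} (hv : ∀ t, HasDerivAt v (u t) t)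
    (hu : ∀ t, HasDerivAt u (u' t) t) {lam : ℝ} (hu' : ∀ t, -lam ≤ u' t) (hlam0 : 0 ≤ lam) (hγlam : lam < γ)
    (Qt : (ι → ℝ) →L[ℝ] (κ → ℝ)) {φ₁ φ₂ e : ι → ℝ} (he : Qt (φ₁ - φ₂ - e) = 0)
    (hagree : ∀ x, e x ≠ 0 → e x = φ₁ x - φ₂ x)
    (hcrit₁ : ∀ h : ι → ℝ, Qt h = 0 →
      fderiv ℝ (fun φ : ι → ℝ => (1 / 2 : ℝ) * ∑ x, φ x * At φ x + ∑ x, v (φ x)) φ₁ h = 0)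
    (hcrit₂ : ∀ h : ι → ℝ, Qt h = 0 →
      fderiv ℝ (fun φ : ι → ℝ => (1 / 2 : ℝ) * ∑ x, φ x * At φ x + ∑ x, v (φ x)) φ₂ h = 0) :
    ((γ - lam) / γ) ^ 2 * ∑ x, (φ₁ x - φ₂ x) * At (φ₁ - φ₂) x ≤ ∑ x, e x * At e x := by
  have hγpos : 0 < γ := hlam0.trans_lt hγlam
  have hpos : ∀ h : ι → ℝ, 0 ≤ ∑ x, h x * At h x := fun h =>
    (mul_nonneg hγpos.le (Finset.sum_nonneg fun x _ => sq_nonneg (h x))).trans (hγ h)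
  have hid := critical_pairing_identity At hAt hv Qt he hcrit₁ hcrit₂
  -- the potential term: `≥ −λ·Σ δ²`
  have hpot : -lam * ∑ x, (φ₁ x - φ₂ x) ^ 2 ≤ ∑ x, (u (φ₁ x) - u (φ₂ x)) * ((φ₁ x - φ₂ x) - e x) := by
    rw [Finset.mul_sum]
    refine Finset.sum_le_sum fun x _ => ?_
    by_cases hx : e x = 0
    · rw [hx, sub_zero]
      exact mul_sub_mul_sub_ge hu hu' (φ₂ x) (φ₁ x)
    · rw [hagree x hx, sub_self, mul_zero]
      exact mul_nonpos_of_nonpos_of_nonneg (neg_nonpos.2 hlam0) (sq_nonneg _)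
  -- the floor on `δ`, nonnegativity, Cauchy–Schwarz
  have hflδ : γ * ∑ x, (φ₁ x - φ₂ x) ^ 2 ≤ ∑ x, (φ₁ x - φ₂ x) * At (φ₁ - φ₂) x := by
    have := hγ (φ₁ - φ₂)
    simpa only [Pi.sub_apply] using this
  have hAδ0 : 0 ≤ ∑ x, (φ₁ x - φ₂ x) * At (φ₁ - φ₂) x := by
    have := hpos (φ₁ - φ₂)
    simpa only [Pi.sub_apply] using this
  have hcs : (∑ x, At (φ₁ - φ₂) x * e x) ^ 2 ≤ (∑ x, (φ₁ x - φ₂ x) * At (φ₁ - φ₂) x) * ∑ x, e x * At e x := by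
    have := form_cauchySchwarz At hAt hpos (φ₁ - φ₂) e
    simpa only [Pi.sub_apply] using this
  set Aδ : ℝ := ∑ x, (φ₁ x - φ₂ x) * At (φ₁ - φ₂) x with hAδ
  set Bδe : ℝ := ∑ x, At (φ₁ - φ₂) x * e x with hB
  set Ce : ℝ := ∑ x, e x * At e x with hC
  set S2 : ℝ := ∑ x, (φ₁ x - φ₂ x) ^ 2 with hS2
  -- `((γ − λ)∕γ)·Aδ ≤ Bδe`
  have hkey : (γ - lam) / γ * Aδ ≤ Bδe := by
    have h1 : Aδ - lam * S2 ≤ Bδe := by linarith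
    have hS : S2 ≤ Aδ / γ := by rw [le_div_iff₀ hγpos]; linarith
    have h2 : lam * S2 ≤ lam / γ * Aδ := by
      calc lam * S2 ≤ lam * (Aδ / γ) := mul_le_mul_of_nonneg_left hS hlam0
        _ = lam / γ * Aδ := by ring
    have h3 : (γ - lam) / γ * Aδ = Aδ - lam / γ * Aδ := by
      rw [sub_div, sub_mul, div_self (ne_of_gt hγpos), one_mul]
    rw [h3]
    linarith
  have hc0 : 0 ≤ (γ - lam) / γ := div_nonneg (sub_nonneg.2 hγlam.le) hγpos.le
  -- conclude: `c²·Aδ² ≤ Bδe² ≤ Aδ·Ce`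
  have h4 : ((γ - lam) / γ) ^ 2 * Aδ * Aδ ≤ Aδ * Ce := by
    calc ((γ - lam) / γ) ^ 2 * Aδ * Aδ = ((γ - lam) / γ * Aδ) ^ 2 := by ring
      _ ≤ Bδe ^ 2 := pow_le_pow_left₀ (mul_nonneg hc0 hAδ0) hkey 2
      _ ≤ Aδ * Ce := hcs
  by_cases hA0 : Aδ = 0
  · rw [hA0, mul_zero]; exact hpos e
  · have hApos : 0 < Aδ := lt_of_le_of_ne hAδ0 (Ne.symm hA0)
    have h5 : ((γ - lam) / γ) ^ 2 * Aδ * Aδ ≤ Ce * Aδ := by rw [mul_comm Ce]; exact h4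
    exact le_of_mul_le_mul_right h5 hApos

/-- **THE DIRICHLET PRINCIPLE, `ℓ²` FORM**: under the same letters, `(γ − λ)²·Σ_x (φ₁ x − φ₂ x)² ≤ γ·Σ_x e x·(At e) x`. [folklore] -/
theorem critical_sq_le_of_agree (At : (ι → ℝ) →L[ℝ] (ι → ℝ))
    (hAt : ∀ φ ψ : ι → ℝ, ∑ x, ψ x * At φ x = ∑ x, φ x * At ψ x) {γ : ℝ}
    (hγ : ∀ h : ι → ℝ, γ * ∑ x, h x ^ 2 ≤ ∑ x, h x * At h x) {v u u' : ℝ → ℝ} (hv : ∀ t, HasDerivAt v (u t) t)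
    (hu : ∀ t, HasDerivAt u (u' t) t) {lam : ℝ} (hu' : ∀ t, -lam ≤ u' t) (hlam0 : 0 ≤ lam) (hγlam : lam < γ)
    (Qt : (ι → ℝ) →L[ℝ] (κ → ℝ)) {φ₁ φ₂ e : ι → ℝ} (he : Qt (φ₁ - φ₂ - e) = 0)
    (hagree : ∀ x, e x ≠ 0 → e x = φ₁ x - φ₂ x)
    (hcrit₁ : ∀ h : ι → ℝ, Qt h = 0 →
      fderiv ℝ (fun φ : ι → ℝ => (1 / 2 : ℝ) * ∑ x, φ x * At φ x + ∑ x, v (φ x)) φ₁ h = 0)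
    (hcrit₂ : ∀ h : ι → ℝ, Qt h = 0 →
      fderiv ℝ (fun φ : ι → ℝ => (1 / 2 : ℝ) * ∑ x, φ x * At φ x + ∑ x, v (φ x)) φ₂ h = 0) :
    (γ - lam) ^ 2 * ∑ x, (φ₁ x - φ₂ x) ^ 2 ≤ γ * ∑ x, e x * At e x := by
  have hγpos : 0 < γ := hlam0.trans_lt hγlam
  have hE := critical_energy_le_of_agree At hAt hγ hv hu hu' hlam0 hγlam Qt he hagree hcrit₁ hcrit₂
  have hflδ : γ * ∑ x, (φ₁ x - φ₂ x) ^ 2 ≤ ∑ x, (φ₁ x - φ₂ x) * At (φ₁ - φ₂) x := by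
    have := hγ (φ₁ - φ₂)
    simpa only [Pi.sub_apply] using this
  have h1 : ((γ - lam) / γ) ^ 2 * (γ * ∑ x, (φ₁ x - φ₂ x) ^ 2) ≤ ∑ x, e x * At e x :=
    (mul_le_mul_of_nonneg_left hflδ (sq_nonneg _)).trans hE
  have h2 : ((γ - lam) / γ) ^ 2 * (γ * ∑ x, (φ₁ x - φ₂ x) ^ 2) = ((γ - lam) ^ 2 * ∑ x, (φ₁ x - φ₂ x) ^ 2) / γ := by
    rw [div_pow, eq_div_iff (ne_of_gt hγpos)]
    field_simp
  rw [h2, div_le_iff₀ hγpos] at h1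
  linarith [h1]

end Generic

/-! ## §2. The torus: two exterior fields, one set of blocks, the same block data -/

section Torus

variable (n : ℕ) (a : ℝ) (s : ℕ) [NeZero s] (Λ : Finset (Site d s))
  {Dop Aop : lp (fun _ : X d => ℝ) ∞ →L[ℝ] lp (fun _ : X d => ℝ) ∞}
  (hD : ∀ (f : lp (fun _ : X d => ℝ) ∞) (y : X d), Dop f y = (((n : ℝ) + 1) ^ d)⁻¹ * ∑ p ∈ B n y, f p)
  (hA : ∀ (f : lp (fun _ : X d => ℝ) ∞) (p : X d), Aop f p = ∑ r ∈ nbhd n p, AX n a p r * f r)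
  {v u u' : ℝ → ℝ} (hv : ∀ t, HasDerivAt v (u t) t) (hu : ∀ t, HasDerivAt u (u' t) t)
  {lam : ℝ} (hu' : ∀ t, -lam ≤ u' t) (hlam0 : 0 ≤ lam) (hγ : lam < min 2 a)
  {Ef : (Site d ((n + 1) * s) → ℝ) →L[ℝ] lp (fun _ : X d => ℝ) ∞}
  (hEf : ∀ (g : Site d ((n + 1) * s) → ℝ) (q : X d), Ef g q = g (siteOf d ((n + 1) * s) q))
  {Rf : lp (fun _ : X d => ℝ) ∞ →L[ℝ] (Site d ((n + 1) * s) → ℝ)}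
  (hRf : ∀ (h : lp (fun _ : X d => ℝ) ∞) (x : Site d ((n + 1) * s)), Rf h x = h (windowMap d ((n + 1) * s) x))
  {Rc : lp (fun _ : X d => ℝ) ∞ →L[ℝ] (Site d s → ℝ)}
  (hRc : ∀ (h : lp (fun _ : X d => ℝ) ∞) (x : Site d s), Rc h x = h (windowMap d s x))
  {QΛ : (Site d ((n + 1) * s) → ℝ) →L[ℝ]
    (({y : Site d s // y ∈ Λ} ⊕ {x : Site d ((n + 1) * s) // siteOf d s (blk n (windowMap d ((n + 1) * s) x)) ∉ Λ}) → ℝ)}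
  (hQl : ∀ (φ : Site d ((n + 1) * s) → ℝ) (y : {y : Site d s // y ∈ Λ}),
    QΛ φ (Sum.inl y) = ((Rc.comp Dop).comp Ef) φ y)
  (hQr : ∀ (φ : Site d ((n + 1) * s) → ℝ)
    (x : {x : Site d ((n + 1) * s) // siteOf d s (blk n (windowMap d ((n + 1) * s) x)) ∉ Λ}), QΛ φ (Sum.inr x) = φ x)

include hD hA hv hu hu' hlam0 hγ hEf hRf hRc hQl hQr in
/-- **THE END: THE DIRICHLET PRINCIPLE FOR THE REGIONAL TORUS BACKGROUND.**  `v′ = u`, `u′` a derivative of `u`, `u′ ≥ −λ` on `ℝ`,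
`0 ≤ λ < min(2,a)`; ANY set of blocks `Λ`, ANY `QΛ` with the displayed actions; `At = Rf∘Aop∘Ef`.  Let `φ₁, φ₂` solve the sitewise
equation at every lattice site over `Ω` and carry the SAME block data on `Λ` (`QΛ φ₁ (inl y) = QΛ φ₂ (inl y)`), with arbitrary
exterior fields; let `e x = φ₁ x − φ₂ x` off `Ω` and `e x = 0` on `Ω` (the exterior difference extended by zero).  Then
`((min(2,a) − λ)∕min(2,a))²·Σ_x δ x·(At δ) x ≤ Σ_x e x·(At e) x` and `(min(2,a) − λ)²·Σ_x δ x² ≤ min(2,a)·Σ_x e x·(At e) x`,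
`δ = φ₁ − φ₂` — every mesh, period, dimension; no smallness of the data. [folklore] -/
theorem regional_exterior_stability {φ₁ φ₂ : Site d ((n + 1) * s) → ℝ}
    (heq₁ : ∀ p : X d, siteOf d s (blk n p) ∈ Λ →
      Aop (Ef φ₁) p + u (Ef φ₁ p) = (((n : ℝ) + 1) ^ d)⁻¹ * ∑ p' ∈ B n (blk n p), (Aop (Ef φ₁) p' + u (Ef φ₁ p')))
    (heq₂ : ∀ p : X d, siteOf d s (blk n p) ∈ Λ →
      Aop (Ef φ₂) p + u (Ef φ₂ p) = (((n : ℝ) + 1) ^ d)⁻¹ * ∑ p' ∈ B n (blk n p), (Aop (Ef φ₂) p' + u (Ef φ₂ p')))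
    (hdata : ∀ y : {y : Site d s // y ∈ Λ}, QΛ φ₁ (Sum.inl y) = QΛ φ₂ (Sum.inl y))
    {e : Site d ((n + 1) * s) → ℝ}
    (heΩ : ∀ x, siteOf d s (blk n (windowMap d ((n + 1) * s) x)) ∈ Λ → e x = 0)
    (heext : ∀ x, siteOf d s (blk n (windowMap d ((n + 1) * s) x)) ∉ Λ → e x = φ₁ x - φ₂ x) :
    ((min 2 a - lam) / min 2 a) ^ 2 * ∑ x, (φ₁ x - φ₂ x) * ((Rf.comp Aop).comp Ef) (φ₁ - φ₂) x
        ≤ ∑ x, e x * ((Rf.comp Aop).comp Ef) e x ∧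
      (min 2 a - lam) ^ 2 * ∑ x, (φ₁ x - φ₂ x) ^ 2 ≤ min 2 a * ∑ x, e x * ((Rf.comp Aop).comp Ef) e x := by
  classical
  have hsymm := torus_operator_form_symm n a s hA hEf hRf
  have hfloor := torus_form_coercive n a s hA hEf hRf
  -- `δ − e ∈ ker QΛ`: zero block data on `Λ`, zero off `Ω`
  have he : QΛ (φ₁ - φ₂ - e) = 0 := by
    funext c
    rcases c with y | x
    · rw [Pi.zero_apply, map_sub, map_sub, Pi.sub_apply, Pi.sub_apply, hdata y, sub_self, zero_sub, hQl,
        neg_eq_zero]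
      -- `e` vanishes on the blocks of `Λ`, so its block mean over `y ∈ Λ` vanishes
      rw [ContinuousLinearMap.comp_apply, ContinuousLinearMap.comp_apply, hRc, hD]
      simp only [hEf]
      rw [Finset.sum_eq_zero fun p hp => ?_, mul_zero]
      exact heΩ _ (by rw [SupTorusDirichletForm.blockOf_siteOf_of_mem n s hp]; exact y.2)
    · rw [Pi.zero_apply, hQr, Pi.sub_apply, Pi.sub_apply, heext x x.2, sub_self]
  have hagree : ∀ x, e x ≠ 0 → e x = φ₁ x - φ₂ x := fun x hx => by
    by_cases hΩ : siteOf d s (blk n (windowMap d ((n + 1) * s) x)) ∈ Λ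
    · exact absurd (heΩ x hΩ) hx
    · exact heext x hΩ
  have hcrit₁ := regional_critical_of_sitewise n a s Λ hD hA hEf hRf hRc hQl hQr hv φ₁ heq₁
  have hcrit₂ := regional_critical_of_sitewise n a s Λ hD hA hEf hRf hRc hQl hQr hv φ₂ heq₂
  exact ⟨critical_energy_le_of_agree ((Rf.comp Aop).comp Ef) hsymm hfloor hv hu hu' hlam0 hγ QΛ he hagree hcrit₁ hcrit₂,
    critical_sq_le_of_agree ((Rf.comp Aop).comp Ef) hsymm hfloor hv hu hu' hlam0 hγ QΛ he hagree hcrit₁ hcrit₂⟩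

end Torus

/-! ## §3. Toy -/

/-- Toy (§1 `form_cauchySchwarz` on one site with `At = 1`): `(f·g)² ≤ (f·f)(g·g)`. -/
example (f g : Unit → ℝ) :
    (∑ x, (1 : (Unit → ℝ) →L[ℝ] (Unit → ℝ)) f x * g x) ^ 2
      ≤ (∑ x, f x * (1 : (Unit → ℝ) →L[ℝ] (Unit → ℝ)) f x) * ∑ x, g x * (1 : (Unit → ℝ) →L[ℝ] (Unit → ℝ)) g x :=
  form_cauchySchwarz (ι := Unit) 1 (fun φ ψ => by simp [mul_comm]) (fun h => by simpa using mul_self_nonneg (h ())) f g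

end Summit.QuantumFields.BalabanUV.T4Continuum.NE7b.SupTorusRegionalExteriorStability

end
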